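import Summits.QuantumFields.GaugeBoot.DiagonalRPTorusInnerHalfNegativeHighDimUniform
import Summits.QuantumFields.GaugeBoot.DiagonalRPTorusClosedHalfNegativeHighDimUniform
import HarnessLib

/-!
# Diagonal RP fails on all tori `(ℤ/L)^d`, `d ≥ 4`, `L ≥ 3`, in ONE coupling window (gauge-boot, L3 uniform window, 6/6)

HONEST FRAMING (cell `pub-gaugeboot`, page 1 of every file): the venture produces certified bounds
on lattice expectations at stated coupling, gauge group, dimension and torus size; NOT a mass gap,
NOT a continuum limit, NOT a string tension; NOT Yang–Mills-summit-bearing (barriers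
`FixedCouplingUltralocality`, `PerturbativeInvisibility`). This module is a structural NEGATIVE
result about which positivity constraints a TORUS certificate may use; it discharges nothing else.

## Content

The assembled statement of the uniform-window sequel, next to `DiagonalRPTorusNegativeAllTori`
(`DiagRPRest.diagonalRP_fails_suN / _uN`: every `d ≥ 3`, every `L ≥ 3`, a window `β₀(L, N, d)`):

* **`DiagRPUnif.diagonalRP_fails_suN_uniform`** — for `N ≥ 2` and every dimension `d ≥ 4` there is
  ONE `β₀ = β₀(N, d) > 0` such that for EVERY side `L ≥ 3` and all `0 < β ≤ β₀` the lattice `SU(N)`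
  Wilson theory on `(ℤ/L)^d` violates diagonal reflection positivity across `x₀ = x₁` — the
  closed-half form (`DiagonalReflectionPositive`) when `L` is odd, the inner-half form
  (`InnerDiagonalRP`) when `L` is even;
* **`DiagRPUnif.diagonalRP_fails_uN_uniform`** — the same for `U(N)`, `N ≥ 1`;
* **`DiagRPUnif.diagonalRP_fails_suN_fixed_coupling`** / **`_uN_fixed_coupling`** — the same
  statements read at FIXED coupling: for every `0 < β ≤ β₀(N, d)` the violation holds on all tori
  `L ≥ 3` at once (so no sequence of tori `L → ∞` at fixed small `β` restores diagonal RP).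

Dispatch: odd `L` → `DiagonalRPTorusClosedHalfNegativeHighDimUniform`, even `L` →
`DiagonalRPTorusInnerHalfNegativeHighDimUniform`. The dimension `d = 3` keeps its `L`-dependent
window (`DiagonalRPTorusNegativeAllTori`): there the witnesses are Polyakov-loop pairs whose leading
order `β^{2L}` grows with `L`, and a uniform window would need the full convergent cluster
expansion; not attempted here. MEANING (one sentence): for the venture's gauge groups and `d ≥ 4`,
torus diagonal RP fails at every fixed small coupling on every torus, so it is not an artefact of
small `L`. Elementary; not in print as far as the cell's searches go (spin-system precedent, no
proof: FILS, J. Stat. Phys. 22 (1980) 297, §3; Biskup, LNM 1970 (2009) §5.5).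
-/

namespace Summit.QuantumFields.GaugeBoot

open Literature.MathematicalPhysics.QuantumFieldTheory
open Literature.MathematicalPhysics.QuantumLattice

noncomputable section

namespace DiagRPUnif

/-- ★★★ **Diagonal RP fails on every torus `(ℤ/L)^d`, `d ≥ 4`, `L ≥ 3`, for `SU(N)` in ONE
coupling window.** For `N ≥ 2` and `d ≥ 4` there is `β₀ > 0` such that for every `L ≥ 3` and all
`0 < β ≤ β₀`: the closed-half diagonal RP statement fails if `L` is odd, the inner-half one if `L`
is even (mirror `x₀ = x₁`). -/
theorem diagonalRP_fails_suN_uniform {d N : ℕ} (hd : 4 ≤ d) (hN : 2 ≤ N) :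
    ∃ β₀ : ℝ, 0 < β₀ ∧ ∀ (L : ℕ) [NeZero L], 3 ≤ L → ∀ β : ℝ, 0 < β → β ≤ β₀ →
      (Odd L → ¬ DiagonalReflectionPositive (d := d) (L := L) (fundamentalRep (Fin N)) β
          ⟨0, by omega⟩ ⟨1, by omega⟩) ∧
        (Even L → ¬ InnerDiagonalRP (d := d) (L := L) (fundamentalRep (Fin N)) β
          ⟨0, by omega⟩ ⟨1, by omega⟩) := by
  obtain ⟨β₁, hβ₁, h₁⟩ := not_diagonalReflectionPositive_odd_suN_highDim_uniform hd hN
  obtain ⟨β₂, hβ₂, h₂⟩ := not_innerDiagonalRP_even_suN_highDim_uniform hd hN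
  refine ⟨min β₁ β₂, lt_min hβ₁ hβ₂, fun L _ hL β hβ hβ0 => ⟨fun hLo => ?_, fun hLe => ?_⟩⟩
  · exact h₁ L hLo hL β hβ (hβ0.trans (min_le_left _ _))
  · have h4 : 4 ≤ L := by obtain ⟨c, hc⟩ := hLe; omega
    exact h₂ L hLe h4 β hβ (hβ0.trans (min_le_right _ _))

/-- ★★★ **Diagonal RP fails on every torus `(ℤ/L)^d`, `d ≥ 4`, `L ≥ 3`, for `U(N)` in ONE
coupling window** (`N ≥ 1`; `N = 1` is compact `U(1)`). -/
theorem diagonalRP_fails_uN_uniform {d N : ℕ} (hd : 4 ≤ d) (hN : 1 ≤ N) :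
    ∃ β₀ : ℝ, 0 < β₀ ∧ ∀ (L : ℕ) [NeZero L], 3 ≤ L → ∀ β : ℝ, 0 < β → β ≤ β₀ →
      (Odd L → ¬ DiagonalReflectionPositive (d := d) (L := L) (unitaryFundamentalRep (Fin N) ℂ) β
          ⟨0, by omega⟩ ⟨1, by omega⟩) ∧
        (Even L → ¬ InnerDiagonalRP (d := d) (L := L) (unitaryFundamentalRep (Fin N) ℂ) β
          ⟨0, by omega⟩ ⟨1, by omega⟩) := by
  obtain ⟨β₁, hβ₁, h₁⟩ := not_diagonalReflectionPositive_odd_uN_highDim_uniform hd hN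
  obtain ⟨β₂, hβ₂, h₂⟩ := not_innerDiagonalRP_even_uN_highDim_uniform hd hN
  refine ⟨min β₁ β₂, lt_min hβ₁ hβ₂, fun L _ hL β hβ hβ0 => ⟨fun hLo => ?_, fun hLe => ?_⟩⟩
  · exact h₁ L hLo hL β hβ (hβ0.trans (min_le_left _ _))
  · have h4 : 4 ≤ L := by obtain ⟨c, hc⟩ := hLe; omega
    exact h₂ L hLe h4 β hβ (hβ0.trans (min_le_right _ _))

/-- ★★★ **Fixed coupling, all tori (`SU(N)`).** For `N ≥ 2`, `d ≥ 4` there is `β₀ > 0` such that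
for every FIXED `0 < β ≤ β₀` diagonal RP across `x₀ = x₁` fails on `(ℤ/L)^d` for ALL `L ≥ 3`
simultaneously (closed half for odd `L`, inner half for even `L`). -/
theorem diagonalRP_fails_suN_fixed_coupling {d N : ℕ} (hd : 4 ≤ d) (hN : 2 ≤ N) :
    ∃ β₀ : ℝ, 0 < β₀ ∧ ∀ β : ℝ, 0 < β → β ≤ β₀ → ∀ (L : ℕ) [NeZero L], 3 ≤ L →
      (Odd L → ¬ DiagonalReflectionPositive (d := d) (L := L) (fundamentalRep (Fin N)) β
          ⟨0, by omega⟩ ⟨1, by omega⟩) ∧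
        (Even L → ¬ InnerDiagonalRP (d := d) (L := L) (fundamentalRep (Fin N)) β
          ⟨0, by omega⟩ ⟨1, by omega⟩) := by
  obtain ⟨β₀, hβ₀, h⟩ := diagonalRP_fails_suN_uniform hd hN
  exact ⟨β₀, hβ₀, fun β hβ hβ1 L _ hL => h L hL β hβ hβ1⟩

/-- ★★★ **Fixed coupling, all tori (`U(N)`, `N ≥ 1`).** -/
theorem diagonalRP_fails_uN_fixed_coupling {d N : ℕ} (hd : 4 ≤ d) (hN : 1 ≤ N) :
    ∃ β₀ : ℝ, 0 < β₀ ∧ ∀ β : ℝ, 0 < β → β ≤ β₀ → ∀ (L : ℕ) [NeZero L], 3 ≤ L →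
      (Odd L → ¬ DiagonalReflectionPositive (d := d) (L := L) (unitaryFundamentalRep (Fin N) ℂ) β
          ⟨0, by omega⟩ ⟨1, by omega⟩) ∧
        (Even L → ¬ InnerDiagonalRP (d := d) (L := L) (unitaryFundamentalRep (Fin N) ℂ) β
          ⟨0, by omega⟩ ⟨1, by omega⟩) := by
  obtain ⟨β₀, hβ₀, h⟩ := diagonalRP_fails_uN_uniform hd hN
  exact ⟨β₀, hβ₀, fun β hβ hβ1 L _ hL => h L hL β hβ hβ1⟩

end DiagRPUnif

end

end Summit.QuantumFields.GaugeBoot
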